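import Literature.Barriers.QuantumAdvantage.AaronsonChenPHMeasure
import Literature.Barriers.QuantumAdvantage.AaronsonChenPHLemma55
import Literature.Computability.QuantumComplexity.OracleSeparationBQPPH
import HarnessLib

/-!
# One level of `O ∼ 𝒟_O`: the readout is uniform and independent of the rest of the oracle

Support for the almost-sure half of Aaronson–Chen 2017, Thm. 5.1 (arXiv:1612.05903, §5.2 and
§5.4 [AaronsonChen2017]). For a fan-in sequence `ws` and a level `ℓ` with `∏ ws ≤ 2^ℓ`, the
leaves `a : Addr ws` are assigned the blocks `B_{ℓ,p}` of prefix `p = acPfx ℓ ws a = natBits ℓ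
(addrIndex ws a)` (injectively), and a coin outcome `ω` of `acCoinMeasure` is split into

* `acReadout ℓ ws ω : Addr ws → Fin (2^ℓ) × Bool` — the hidden position and the block coin of
  each assigned block ("with probability `0.5` … pick an element `e` in `B_{n,p}` at uniformly
  random", §5.2 p. 20), and
* `acRest ℓ ws ω : Set (List Bool)` — the oracle `acOracleOf ω` off the assigned window strings
  `acWinStr ℓ ws (a, j) = acPfx a ++ natBits ℓ j`.

Proved here: the window of the oracle on the assigned blocks is the `blockWin` (file
`AaronsonChenPHLemma55.lean`) of the readout (`acOracleWin_acOracleOf`); the oracle is the rest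
patched by that window (`patchLang_acRest`), and patching commutes with the join `A ⊕ ·`
(`patchLang_oracleJoin`); the readout is UNIFORM (`acCoinMeasure_acReadout_eq`: each value has
probability `2^{-(ℓ+1)n}`, a cylinder on the `(ℓ+1)n` level coins; `acCoinMeasure_acReadout_mem_le`)
and INDEPENDENT of the rest (`indepFun_acReadout_acRest`: they read disjoint sets of coins,
`acLevelCoins` and its complement — "`g(p)` … is a uniform random function … by construction",
§5.2 p. 20), both measurable. These are the inputs of the conditioning step
(`measure_rel_inter_le`, `AaronsonChenPHMeasure.lean`) in `AaronsonChenPHLowerBound.lean`.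

## Sources

* [AaronsonChen2017] arXiv:1612.05903, `lit read` pp. 20–21 (§5.2: `B_{n,p}`, `𝒟_n`, `𝒟_O`,
  independence by construction), p. 24 (§5.4).
-/

noncomputable section

namespace Literature.Barriers.QuantumAdvantage

open MeasureTheory ProbabilityTheory _root_.Computability
  Literature.Computability.QuantumComplexity Finset
open Literature.Computability.Complexity hiding natBits length_natBits
open scoped ENNReal

variable (ℓ : ℕ) (ws : List ℕ)

/-! ### Positions as bit vectors -/

/-- The `ℓ` low-order bits of a position `j < 2^ℓ`. [folklore] -/
def toBits (j : Fin (2 ^ ℓ)) : Fin ℓ → Bool := fun t => (j : ℕ).testBit t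

/-- `natBits` lists `toBits`. [folklore] -/
theorem natBits_eq_ofFn_toBits (j : Fin (2 ^ ℓ)) : natBits ℓ j = List.ofFn (toBits ℓ j) := rfl

/-- Positions below `2^ℓ` are determined by their `ℓ` low-order bits. [folklore] -/
theorem toBits_injective : Function.Injective (toBits ℓ) := by
  intro j j' h
  have h' : natBits ℓ j = natBits ℓ j' := by
    rw [natBits_eq_ofFn_toBits, natBits_eq_ofFn_toBits, h]
  exact Fin.ext (natBits_injective j.isLt j'.isLt h')

/-- Positions `j < 2^ℓ` correspond bijectively to bit vectors of length `ℓ`. [folklore] -/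
def bitsEquiv : Fin (2 ^ ℓ) ≃ (Fin ℓ → Bool) :=
  Equiv.ofBijective (toBits ℓ)
    ((Fintype.bijective_iff_injective_and_card _).2 ⟨toBits_injective ℓ, by simp⟩)

/-- `bitsEquiv` is `toBits`. [folklore] -/
@[simp] theorem bitsEquiv_apply (j : Fin (2 ^ ℓ)) : bitsEquiv ℓ j = toBits ℓ j := rfl

/-- Every string of length `ℓ` is `natBits ℓ j` for the position `j` with these bits. [folklore] -/
theorem natBits_bitsEquiv_symm (e : List Bool) (he : e.length = ℓ) :
    natBits ℓ ((bitsEquiv ℓ).symm fun t => e.get (Fin.cast he.symm t)) = e := by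
  have h1 : toBits ℓ ((bitsEquiv ℓ).symm fun t => e.get (Fin.cast he.symm t)) =
      fun t => e.get (Fin.cast he.symm t) := by
    rw [← bitsEquiv_apply, Equiv.apply_symm_apply]
  rw [natBits_eq_ofFn_toBits, h1]
  subst he
  exact List.ofFn_get e

/-- The entries of `natBits` are the bits. [folklore] -/
theorem get_natBits (w v : ℕ) (i : Fin (natBits w v).length) : (natBits w v).get i = v.testBit i := by
  unfold natBits
  rw [List.get_ofFn]
  simp

/-! ### Blocks assigned to leaves, window strings, readout and rest -/

/-- The block prefix `p ∈ {0,1}^ℓ` assigned to the leaf `a`: the binary expansion of its leaf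
number. [cite: AaronsonChen2017, §5.2 (p. 20, blocks B_{n,p}) and Lemma 5.5 (p. 24)] -/
def acPfx (a : Addr ws) : List Bool := natBits ℓ (addrIndex ws a)

/-- Block prefixes have length `ℓ`. [folklore] -/
@[simp] theorem length_acPfx (a : Addr ws) : (acPfx ℓ ws a).length = ℓ := length_natBits _ _

/-- With at most `2^ℓ` leaves the block assignment is injective. [folklore] -/
theorem acPfx_injective (h : ws.prod ≤ 2 ^ ℓ) : Function.Injective (acPfx ℓ ws) := fun a b hab =>
  addrIndex_injective ws (natBits_injective (lt_of_lt_of_le (addrIndex_lt ws a) h)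
    (lt_of_lt_of_le (addrIndex_lt ws b) h) hab)

/-- The window string of position `j` in the block of leaf `a`: `p_a · natBits ℓ j ∈ {0,1}^{2ℓ}`.
[cite: AaronsonChen2017, §5.2 (p. 20)] -/
def acWinStr (p : Addr ws × Fin (2 ^ ℓ)) : List Bool := acPfx ℓ ws p.1 ++ natBits ℓ p.2

/-- Window strings have length `2ℓ`. [folklore] -/
@[simp] theorem length_acWinStr (p : Addr ws × Fin (2 ^ ℓ)) : (acWinStr ℓ ws p).length = 2 * ℓ := by
  simp [acWinStr]; ring

/-- Window strings are distinct. [folklore] -/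
theorem acWinStr_injective (h : ws.prod ≤ 2 ^ ℓ) : Function.Injective (acWinStr ℓ ws) := by
  rintro ⟨a, j⟩ ⟨b, j'⟩ hab
  obtain ⟨h1, h2⟩ := List.append_inj hab (by simp)
  have ha := acPfx_injective ℓ ws h h1
  have hj := Fin.ext (natBits_injective j.isLt j'.isLt h2)
  subst ha; subst hj; rfl

/-- **The level readout** of a coin outcome: for each leaf `a`, the hidden position (the position
bits `[inr (p_a, t) ∈ ω]`, `t < ℓ`) and the block coin `[inl p_a ∈ ω]` of its block.
[cite: AaronsonChen2017, §5.2 (pp. 20–21)] -/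
def acReadout (ω : Set AcCoin) (a : Addr ws) : Fin (2 ^ ℓ) × Bool :=
  ((bitsEquiv ℓ).symm fun t => ω.boolIndicator (Sum.inr (acPfx ℓ ws a, (t : ℕ))),
    ω.boolIndicator (Sum.inl (acPfx ℓ ws a)))

/-- The window of an oracle on the assigned blocks of level `ℓ`: bit `(a, j)` is
`[p_a · natBits ℓ j ∈ O]`. [cite: AaronsonChen2017, §5.2 (p. 20) and Lemma 5.5 (p. 24)] -/
def acOracleWin (O : Set (List Bool)) : Addr ws × Fin (2 ^ ℓ) → Bool :=
  fun p => O.boolIndicator (acWinStr ℓ ws p)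

/-- **The window of `acOracleOf ω` is the `blockWin` of the readout**: `p_a · e ∈ O` iff the block
coin of `p_a` is heads and `e` is the hidden position. [cite: AaronsonChen2017, §5.2 (pp. 20–21)] -/
theorem acOracleWin_acOracleOf (ω : Set AcCoin) :
    acOracleWin ℓ ws (acOracleOf ω) = blockWin (acReadout ℓ ws ω) := by
  funext ⟨a, j⟩
  have hmem : acPfx ℓ ws a ++ natBits ℓ j ∈ acOracleOf ω ↔ Sum.inl (acPfx ℓ ws a) ∈ ω ∧
      ∀ i : Fin (natBits ℓ j).length, Sum.inr (acPfx ℓ ws a, (i : ℕ)) ∈ ω ↔ (natBits ℓ j).get i = true :=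
    Set.ext_iff.1 (acOracleOf_preimage_mem (acPfx ℓ ws a) (natBits ℓ (j : ℕ)) (by simp)) ω
  have hpos : j = ((bitsEquiv ℓ).symm fun t => ω.boolIndicator (Sum.inr (acPfx ℓ ws a, (t : ℕ)))) ↔
      ∀ i : Fin (natBits ℓ j).length, Sum.inr (acPfx ℓ ws a, (i : ℕ)) ∈ ω ↔ (natBits ℓ j).get i = true := by
    rw [Equiv.eq_symm_apply, bitsEquiv_apply]
    constructor
    · intro h i
      have hi : (j : ℕ).testBit i = ω.boolIndicator (Sum.inr (acPfx ℓ ws a, (i : ℕ))) :=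
        congr_fun h (Fin.cast (length_natBits ℓ j) i)
      rw [get_natBits, hi, ← Set.mem_iff_boolIndicator]
    · intro h
      funext t
      have ht := h (Fin.cast (length_natBits ℓ j).symm t)
      rw [get_natBits] at ht
      change Sum.inr (acPfx ℓ ws a, (t : ℕ)) ∈ ω ↔ (j : ℕ).testBit t = true at ht
      show (j : ℕ).testBit t = ω.boolIndicator (Sum.inr (acPfx ℓ ws a, (t : ℕ)))
      rcases hb : (j : ℕ).testBit t with _ | _
      · rw [hb] at ht
        exact ((Set.notMem_iff_boolIndicator _ _).1 fun hm => by simpa using ht.1 hm).symm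
      · rw [hb] at ht
        exact ((Set.mem_iff_boolIndicator _ _).1 (ht.2 rfl)).symm
  rw [Bool.eq_iff_iff]
  change (acOracleOf ω).boolIndicator (acPfx ℓ ws a ++ natBits ℓ j) = true ↔
    (ω.boolIndicator (Sum.inl (acPfx ℓ ws a)) &&
      decide (j = (bitsEquiv ℓ).symm fun t => ω.boolIndicator (Sum.inr (acPfx ℓ ws a, (t : ℕ))))) = true
  rw [← Set.mem_iff_boolIndicator, hmem, Bool.and_eq_true, ← Set.mem_iff_boolIndicator,
    decide_eq_true_iff, hpos]

/-- **The rest of the oracle**: `acOracleOf ω` without the assigned window strings of level `ℓ`.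
[cite: AaronsonChen2017, §5.2 (p. 21)] -/
def acRest (ω : Set AcCoin) : Set (List Bool) :=
  {z | z ∈ acOracleOf ω ∧ z ∉ Set.range (acWinStr ℓ ws)}

/-- Off the window the rest is the oracle. [folklore] -/
theorem mem_acRest_iff_of_not_mem_range {ω : Set AcCoin} {z : List Bool}
    (hz : z ∉ Set.range (acWinStr ℓ ws)) : z ∈ acRest ℓ ws ω ↔ z ∈ acOracleOf ω :=
  ⟨fun h => h.1, fun h => ⟨h, hz⟩⟩

/-- Strings of length `≠ 2ℓ` are decided by the rest. [folklore] -/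
theorem mem_acRest_iff_of_length_ne {ω : Set AcCoin} {z : List Bool} (hz : z.length ≠ 2 * ℓ) :
    z ∈ acRest ℓ ws ω ↔ z ∈ acOracleOf ω :=
  mem_acRest_iff_of_not_mem_range ℓ ws (by rintro ⟨p, rfl⟩; exact hz (length_acWinStr ℓ ws p))

/-- **Reconstruction**: the oracle is its rest patched, on the assigned window, by the `blockWin`
of its readout. [cite: AaronsonChen2017, §5.2 (pp. 20–21)] -/
theorem patchLang_acRest (h : ws.prod ≤ 2 ^ ℓ) (ω : Set AcCoin) :
    patchLang (acRest ℓ ws ω) (acWinStr ℓ ws) (blockWin (acReadout ℓ ws ω)) = acOracleOf ω := by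
  ext z
  by_cases hz : z ∈ Set.range (acWinStr ℓ ws)
  · obtain ⟨p, rfl⟩ := hz
    rw [mem_patchLang_of_eq (acWinStr_injective ℓ ws h), ← acOracleWin_acOracleOf]
    exact (Set.mem_iff_boolIndicator _ _).symm
  · have hne : ∀ k, acWinStr ℓ ws k ≠ z := fun k hk => hz ⟨k, hk⟩
    rw [mem_patchLang_of_not_mem_range _ hne]
    exact mem_acRest_iff_of_not_mem_range ℓ ws hz

/-- Patching a window of the right oracle commutes with the join: the window strings of `O` sit at
`1 · (window string)` in `A ⊕ O`. [cite: AaronsonChen2017, §5 (p. 20, O₀ ⊕ O₁)] -/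
theorem patchLang_oracleJoin {ι : Type*} (A O : Language Bool) (e : ι → List Bool) (w : ι → Bool) :
    patchLang (oracleJoin A O) (fun k => true :: e k) w = oracleJoin A (patchLang O e w) := by
  ext s
  change ((∃ k, true :: e k = s ∧ w k = true) ∨ ((∀ k, true :: e k ≠ s) ∧ s ∈ oracleJoin A O)) ↔
    s ∈ oracleJoin A (patchLang O e w)
  rcases s with _ | ⟨b, t⟩
  · simp
  · cases b
    · simp
    · rw [true_cons_mem_oracleJoin, true_cons_mem_oracleJoin]
      change _ ↔ ((∃ k, e k = t ∧ w k = true) ∨ ((∀ k, e k ≠ t) ∧ t ∈ O))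
      simp

/-- Re-indexing the window along a bijection does not change the patched language. [folklore] -/
theorem patchLang_comp_equiv {ι κ : Type*} (A₀ : Language Bool) (e : ι → List Bool) (w : ι → Bool)
    (ε : κ ≃ ι) : patchLang A₀ (e ∘ ε) (w ∘ ε) = patchLang A₀ e w := by
  ext s
  change ((∃ k, e (ε k) = s ∧ w (ε k) = true) ∨ ((∀ k, e (ε k) ≠ s) ∧ s ∈ A₀)) ↔
    ((∃ k, e k = s ∧ w k = true) ∨ ((∀ k, e k ≠ s) ∧ s ∈ A₀))
  constructor
  · rintro (⟨k, hk, hw⟩ | ⟨hne, hs⟩)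
    · exact Or.inl ⟨ε k, hk, hw⟩
    · exact Or.inr ⟨fun k hk => hne (ε.symm k) (by simpa using hk), hs⟩
  · rintro (⟨k, hk, hw⟩ | ⟨hne, hs⟩)
    · exact Or.inl ⟨ε.symm k, by simpa using hk, by simpa using hw⟩
    · exact Or.inr ⟨fun k hk => hne (ε k) hk, hs⟩

/-! ### The level coins; uniformity of the readout -/

/-- The coins of the assigned blocks of level `ℓ`: the block coins `inl p_a` and ALL position
coins `inr (p_a, t)` (also the unread ones, `t ≥ ℓ`). [cite: AaronsonChen2017, §5.2 (pp. 20–21)] -/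
def acLevelCoins : Set AcCoin :=
  {c | ∃ a : Addr ws, c = Sum.inl (acPfx ℓ ws a) ∨ ∃ t : ℕ, c = Sum.inr (acPfx ℓ ws a, t)}

/-- The coins actually read by the readout, indexed by (leaf, block coin or position bit). [folklore] -/
def acCoinOf (q : Addr ws × Option (Fin ℓ)) : AcCoin :=
  match q.2 with
  | none => Sum.inl (acPfx ℓ ws q.1)
  | some t => Sum.inr (acPfx ℓ ws q.1, (t : ℕ))

/-- The read coins are level coins. [folklore] -/
theorem acCoinOf_mem (q : Addr ws × Option (Fin ℓ)) : acCoinOf ℓ ws q ∈ acLevelCoins ℓ ws := by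
  rcases q with ⟨a, _ | t⟩
  · exact ⟨a, Or.inl rfl⟩
  · exact ⟨a, Or.inr ⟨t, rfl⟩⟩

/-- Distinct indices read distinct coins. [folklore] -/
theorem acCoinOf_injective (h : ws.prod ≤ 2 ^ ℓ) : Function.Injective (acCoinOf ℓ ws) := by
  rintro ⟨a, _ | t⟩ ⟨b, _ | t'⟩ hq
  · simp only [acCoinOf, Sum.inl.injEq] at hq
    rw [acPfx_injective ℓ ws h hq]
  · simp [acCoinOf] at hq
  · simp [acCoinOf] at hq
  · simp only [acCoinOf, Sum.inr.injEq, Prod.mk.injEq] at hq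
    rw [acPfx_injective ℓ ws h hq.1, Fin.ext hq.2]

/-- The prescribed value of a read coin for the readout value `c`. [folklore] -/
def acCoinVal (c : Addr ws → Fin (2 ^ ℓ) × Bool) (q : Addr ws × Option (Fin ℓ)) : Prop :=
  match q.2 with
  | none => (c q.1).2 = true
  | some t => toBits ℓ (c q.1).1 t = true

/-- **The fibres of the readout are cylinders**: `acReadout ω = c` iff every read coin has its
prescribed value. [cite: AaronsonChen2017, §5.2 (pp. 20–21)] -/
theorem acReadout_eq_iff (ω : Set AcCoin) (c : Addr ws → Fin (2 ^ ℓ) × Bool) :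
    acReadout ℓ ws ω = c ↔ ∀ q : Addr ws × Option (Fin ℓ), acCoinOf ℓ ws q ∈ ω ↔ acCoinVal ℓ ws c q := by
  constructor
  · rintro rfl ⟨a, _ | t⟩
    · show Sum.inl (acPfx ℓ ws a) ∈ ω ↔ ω.boolIndicator (Sum.inl (acPfx ℓ ws a)) = true
      exact Set.mem_iff_boolIndicator _ _
    · show Sum.inr (acPfx ℓ ws a, (t : ℕ)) ∈ ω ↔
        toBits ℓ ((bitsEquiv ℓ).symm fun t => ω.boolIndicator (Sum.inr (acPfx ℓ ws a, (t : ℕ)))) t = true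
      rw [← bitsEquiv_apply, Equiv.apply_symm_apply]
      exact Set.mem_iff_boolIndicator _ _
  · intro hq
    funext a
    refine Prod.ext ?_ ?_
    · show ((bitsEquiv ℓ).symm fun t => ω.boolIndicator (Sum.inr (acPfx ℓ ws a, (t : ℕ)))) = (c a).1
      rw [Equiv.symm_apply_eq, bitsEquiv_apply]
      funext t
      have h := hq (a, some t)
      change Sum.inr (acPfx ℓ ws a, (t : ℕ)) ∈ ω ↔ toBits ℓ (c a).1 t = true at h
      rcases hb : toBits ℓ (c a).1 t with _ | _
      · rw [hb] at h
        exact (Set.notMem_iff_boolIndicator _ _).1 fun hm => by simpa using h.1 hm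
      · rw [hb] at h
        exact (Set.mem_iff_boolIndicator _ _).1 (h.2 rfl)
    · show ω.boolIndicator (Sum.inl (acPfx ℓ ws a)) = (c a).2
      have h := hq (a, none)
      change Sum.inl (acPfx ℓ ws a) ∈ ω ↔ (c a).2 = true at h
      rcases hb : (c a).2 with _ | _
      · rw [hb] at h
        exact (Set.notMem_iff_boolIndicator _ _).1 fun hm => by simpa using h.1 hm
      · rw [hb] at h
        exact (Set.mem_iff_boolIndicator _ _).1 (h.2 rfl)

/-- The read coins as a finset and the prescribed values as a predicate on coins (for the cylinder
formula). [folklore] -/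
theorem acReadout_fiber_eq (h : ws.prod ≤ 2 ^ ℓ) (c : Addr ws → Fin (2 ^ ℓ) × Bool) :
    acReadout ℓ ws ⁻¹' {c} =
      {ω | ∀ x ∈ (univ : Finset (Addr ws × Option (Fin ℓ))).image (acCoinOf ℓ ws),
        x ∈ ω ↔ ∃ q, acCoinOf ℓ ws q = x ∧ acCoinVal ℓ ws c q} := by
  ext ω
  simp only [Set.mem_preimage, Set.mem_singleton_iff, acReadout_eq_iff, Finset.mem_image,
    Finset.mem_univ, true_and, Set.mem_setOf_eq, forall_exists_index, forall_apply_eq_imp_iff]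
  refine forall_congr' fun q => ?_
  constructor
  · intro hq
    rw [hq]
    constructor
    · exact fun hv => ⟨q, rfl, hv⟩
    · rintro ⟨q', hq', hv'⟩
      rwa [← acCoinOf_injective ℓ ws h hq']
  · intro hq
    rw [hq]
    constructor
    · rintro ⟨q', hq', hv'⟩
      rwa [← acCoinOf_injective ℓ ws h hq']
    · exact fun hv => ⟨q, rfl, hv⟩

/-- There are `(ℓ + 1) n` read coins. [folklore] -/
theorem card_image_acCoinOf (h : ws.prod ≤ 2 ^ ℓ) :
    ((univ : Finset (Addr ws × Option (Fin ℓ))).image (acCoinOf ℓ ws)).card = ws.prod * (ℓ + 1) := by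
  rw [Finset.card_image_of_injective _ (acCoinOf_injective ℓ ws h), Finset.card_univ,
    Fintype.card_prod, Fintype.card_option, Fintype.card_fin, Addr.card]

/-- **The readout is uniform**: each value has probability `2^{-(ℓ+1) n}` (the block coin and the
`ℓ` position bits of each of the `n` blocks — "with probability `0.5`", "uniformly at random").
[cite: AaronsonChen2017, §5.2 (p. 20)] -/
theorem acCoinMeasure_acReadout_eq (h : ws.prod ≤ 2 ^ ℓ) (c : Addr ws → Fin (2 ^ ℓ) × Bool) :
    acCoinMeasure (acReadout ℓ ws ⁻¹' {c}) = 2⁻¹ ^ (ws.prod * (ℓ + 1)) := by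
  rw [acReadout_fiber_eq ℓ ws h c, acCoinMeasure_cylinder, card_image_acCoinOf ℓ ws h]

/-- The readout is measurable with respect to the level coins. [folklore] -/
theorem measurable_acReadout (h : ws.prod ≤ 2 ^ ℓ) :
    Measurable[coinSigma (acLevelCoins ℓ ws)] (acReadout ℓ ws) := by
  refine measurable_coinSigma_of_fibers fun c => ⟨_, _, ?_, acReadout_fiber_eq ℓ ws h c⟩
  intro x hx
  obtain ⟨q, -, rfl⟩ := Finset.mem_image.1 (Finset.mem_coe.1 hx)
  exact acCoinOf_mem ℓ ws q

/-- The readout is measurable. [folklore] -/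
theorem measurable_acReadout' (h : ws.prod ≤ 2 ^ ℓ) : Measurable (acReadout ℓ ws) :=
  (measurable_acReadout ℓ ws h).mono (coinSigma_le _) le_rfl

/-- The probability that the readout lies in a finite set `S` of values is `|S| · 2^{-(ℓ+1)n}`.
[cite: AaronsonChen2017, §5.2 (p. 20)] -/
theorem acCoinMeasure_acReadout_mem (h : ws.prod ≤ 2 ^ ℓ) (S : Finset (Addr ws → Fin (2 ^ ℓ) × Bool)) :
    acCoinMeasure {ω | acReadout ℓ ws ω ∈ S} = S.card * 2⁻¹ ^ (ws.prod * (ℓ + 1)) := by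
  classical
  have hset : {ω | acReadout ℓ ws ω ∈ S} = ⋃ c ∈ S, acReadout ℓ ws ⁻¹' {c} := by
    ext ω; simp
  rw [hset, measure_biUnion_finset]
  · rw [Finset.sum_congr rfl fun c _ => acCoinMeasure_acReadout_eq ℓ ws h c, Finset.sum_const,
      nsmul_eq_mul]
  · intro c _ c' _ hcc'
    exact Set.disjoint_left.2 fun ω h1 h2 => hcc' (h1.symm.trans h2)
  · intro c _
    exact measurable_acReadout' ℓ ws h (measurableSet_singleton c)

/-- The number of readout values is `(2 · 2^ℓ)ⁿ = 2^{(ℓ+1)n}`. [folklore] -/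
theorem card_readout : (Fintype.card (Addr ws → Fin (2 ^ ℓ) × Bool) : ℝ) = 2 ^ (ws.prod * (ℓ + 1)) := by
  rw [Fintype.card_fun, Fintype.card_prod, Fintype.card_fin, Fintype.card_bool, Addr.card]
  push_cast
  rw [← pow_succ, ← pow_mul, mul_comm]

/-- **Uniformity as an inequality**: if a finite set of readout values has at most a `θ`-fraction
of all values, the readout lies in it with probability at most `θ`. [cite: AaronsonChen2017, §5.2 (p. 20)] -/
theorem acCoinMeasure_acReadout_mem_le (h : ws.prod ≤ 2 ^ ℓ)
    (S : Finset (Addr ws → Fin (2 ^ ℓ) × Bool)) {θ : ℝ}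
    (hS : (S.card : ℝ) ≤ θ * Fintype.card (Addr ws → Fin (2 ^ ℓ) × Bool)) :
    acCoinMeasure {ω | acReadout ℓ ws ω ∈ S} ≤ ENNReal.ofReal θ := by
  rw [acCoinMeasure_acReadout_mem ℓ ws h S]
  rw [card_readout] at hS
  have h2 : (2⁻¹ : ℝ≥0∞) ^ (ws.prod * (ℓ + 1)) = ENNReal.ofReal ((2 : ℝ) ^ (ws.prod * (ℓ + 1)))⁻¹ := by
    rw [ENNReal.ofReal_inv_of_pos (by positivity), ENNReal.ofReal_pow (by norm_num), ENNReal.ofReal_ofNat,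
      ENNReal.inv_pow]
  have hpos : (0 : ℝ) < 2 ^ (ws.prod * (ℓ + 1)) := by positivity
  rw [h2, ← ENNReal.ofReal_natCast, ← ENNReal.ofReal_mul (Nat.cast_nonneg _)]
  refine ENNReal.ofReal_le_ofReal ?_
  rwa [mul_inv_le_iff₀ hpos, mul_comm] at *

/-! ### The rest reads the other coins; independence -/

/-- A string `p · e` with `|e| = |p|` whose prefix is an assigned block prefix is a window string.
[folklore] -/
theorem mem_range_acWinStr_of_eq {p e : List Bool} (he : e.length = p.length) {a : Addr ws}
    (hp : p = acPfx ℓ ws a) : p ++ e ∈ Set.range (acWinStr ℓ ws) := by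
  subst hp
  have hl : e.length = ℓ := by simpa using he
  refine ⟨(a, (bitsEquiv ℓ).symm fun t => e.get (Fin.cast hl.symm t)), ?_⟩
  simp only [acWinStr]
  rw [natBits_bitsEquiv_symm ℓ e hl]

/-- Membership of a fixed string in the rest is an event of the non-level coins. [folklore] -/
theorem measurableSet_mem_acRest (z : List Bool) :
    MeasurableSet[coinSigma (acLevelCoins ℓ ws)ᶜ] {ω | z ∈ acRest ℓ ws ω} := by
  by_cases hz : z ∈ Set.range (acWinStr ℓ ws)
  · have : {ω | z ∈ acRest ℓ ws ω} = ∅ :=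
      Set.eq_empty_iff_forall_notMem.2 fun ω hω => hω.2 hz
    rw [this]
    exact @MeasurableSet.empty _ (coinSigma _)
  -- off the window: `z ∈ acOracleOf ω`, a cylinder on the coins of the prefix of `z`
  have hset : {ω | z ∈ acRest ℓ ws ω} = {ω | z ∈ acOracleOf ω} := by
    ext ω; exact mem_acRest_iff_of_not_mem_range ℓ ws hz
  rw [hset]
  by_cases hev : ∃ p e : List Bool, z = p ++ e ∧ e.length = p.length
  · obtain ⟨p, e, rfl, he⟩ := hev
    have hpre : {ω : Set AcCoin | p ++ e ∈ acOracleOf ω} = {S | Sum.inl p ∈ S ∧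
        ∀ i : Fin e.length, Sum.inr (p, (i : ℕ)) ∈ S ↔ e.get i = true} :=
      acOracleOf_preimage_mem p e he
    rw [hpre]
    have hp : ∀ a, p ≠ acPfx ℓ ws a := fun a ha => hz (mem_range_acWinStr_of_eq ℓ ws he ha)
    have hinl : Sum.inl p ∈ (acLevelCoins ℓ ws)ᶜ := by
      rintro ⟨a, ha | ⟨t, ht⟩⟩
      · exact hp a (Sum.inl.inj ha)
      · cases ht
    have hinr : ∀ i : ℕ, Sum.inr (p, i) ∈ (acLevelCoins ℓ ws)ᶜ := by
      rintro i ⟨a, ha | ⟨t, ht⟩⟩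
      · cases ha
      · simp only [Sum.inr.injEq, Prod.mk.injEq] at ht
        exact hp a ht.1
    have h1 : MeasurableSet[coinSigma (acLevelCoins ℓ ws)ᶜ] {S : Set AcCoin | Sum.inl p ∈ S} :=
      measurableSet_coinSigma_coinEvent hinl
    have h2 : MeasurableSet[coinSigma (acLevelCoins ℓ ws)ᶜ]
        {S : Set AcCoin | ∀ i : Fin e.length, Sum.inr (p, (i : ℕ)) ∈ S ↔ e.get i = true} := by
      have : {S : Set AcCoin | ∀ i : Fin e.length, Sum.inr (p, (i : ℕ)) ∈ S ↔ e.get i = true} =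
          ⋂ i : Fin e.length, {S | Sum.inr (p, (i : ℕ)) ∈ S ↔ e.get i = true} := by
        ext S; simp
      rw [this]
      exact MeasurableSet.iInter fun i => measurableSet_coinSigma_iff (hinr i) _
    exact h1.inter h2
  · have : {ω : Set AcCoin | z ∈ acOracleOf ω} = ∅ := by
      ext ω
      simp only [Set.mem_setOf_eq, Set.mem_empty_iff_false, iff_false]
      rintro ⟨p, e, hz', he, -, -⟩
      exact hev ⟨p, e, hz', he⟩
    rw [this]
    exact @MeasurableSet.empty _ (coinSigma _)

/-- The rest is measurable with respect to the non-level coins. [folklore] -/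
theorem measurable_acRest : Measurable[coinSigma (acLevelCoins ℓ ws)ᶜ] (acRest ℓ ws) :=
  measurable_coinSigma_set fun z => measurableSet_mem_acRest ℓ ws z

/-- The rest is measurable. [folklore] -/
theorem measurable_acRest' : Measurable (acRest ℓ ws) :=
  (measurable_acRest ℓ ws).mono (coinSigma_le _) le_rfl

/-- **The readout of a level is independent of the rest of the oracle** (they read disjoint sets
of coins). [cite: AaronsonChen2017, §5.2 (p. 20, "independently"; p. 21, 𝒟_O draws each f_n independently)] -/
theorem indepFun_acReadout_acRest (h : ws.prod ≤ 2 ^ ℓ) :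
    IndepFun (acReadout ℓ ws) (acRest ℓ ws) acCoinMeasure :=
  indepFun_of_coinSigma disjoint_compl_right (measurable_acReadout ℓ ws h) (measurable_acRest ℓ ws)

end Literature.Barriers.QuantumAdvantage

end
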